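import Literature.Analysis.FluidPDE.TaoCascadeRescaledBootstrap
import Literature.Analysis.FluidPDE.TaoCascadeRescaledRegime
import HarnessLib

/-!
# Tao's cascade ODE, §6.5: Prop. 6.12 (reduced induction claim) and Prop. 6.5 ⇐ Cor. 6.11 ∧ Prop. 6.12

T. Tao, *Finite time blowup for an averaged three-dimensional Navier–Stokes equation*,
J. Amer. Math. Soc. 29 (2016), 601–674 = arXiv:1402.0290v3, §6.5: Cor. 6.11 (6.101)–(6.103),
Prop. 6.12 (6.104)–(6.114) and the paragraph after it (equation numbers of arXiv v3).

After Lemma 6.8 (`TaoCascadeRescaledBootstrap.lean`: the bootstrap regime `GoodAt` = (6.92)–(6.95),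
the time `T1 := maximalTimeP (GoodAt …) 0 100`) and Lemma 6.10 / Cor. 6.11 (exit trichotomy at `T₁`),
§6.5 ends with: "Thanks to (6.92)–(6.95), the task of proving Proposition 6.5 has now reduced to …
**Proposition 6.12 (Reduced induction claim)** … Indeed, the remaining claims (6.73), (6.79), (6.80),
(6.81) of Proposition 6.5 follow for `τ₁` obeying (6.104) from (6.92)–(6.95) (using (6.105) to handle
the `μ₁` factor in (6.73))."

This file
* states Prop. 6.12 as a named fact `reducedClaimWith γ` (`InRegime` form of
  `TaoCascadeRescaledRegime.lean`; corrected instance `reducedClaimCorrected`), relative to an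
  *abstract bootstrap time* `IsBootstrapTime … T` — a time `0 < T ≤ 100` with `GoodAt` on `[0, T]`
  and the exit trichotomy of Cor. 6.11 at `T`; these are the only properties of `T₁` used in
  §6.6–6.7, and `T1` has them as soon as Cor. 6.11 holds at `T1` (`isBootstrapTime_T1`, which also
  extracts `T₁ > 0` from the strict initial bounds of Lemma 6.8);
* proves the quoted deduction: `RescaledConclusion.of_reduced` (pointwise) and, in the regime,
  `rescaledStepWith'_of_reducedClaim : InRegime γ (Cor. 6.11 at T1) → reducedClaimWith γ →
  rescaledStepWith' γ` for `γ(K) ≤ 10⁻⁵` (where Lemma 6.8 enters, via `goodAt_zero`), with the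
  corrected instance `rescaledStepCorrected'_of_reducedClaim`.

What is NOT here: Cor. 6.11 itself (Lemmas 6.9–6.10; sibling file in progress) and the proof of
Prop. 6.12 (Props. 6.13–6.17, §6.6–6.7).

## References

* T. Tao, J. Amer. Math. Soc. 29 (2016), 601–674 = arXiv:1402.0290v3, §6.5 Cor. 6.11, Prop. 6.12
  and the paragraph following it. [`Tao2016AveragedNS`]
-/

noncomputable section

open Set Filter
open scoped _root_.Topology

namespace Literature.Analysis.FluidPDE

namespace TaoCascade

open Literature.Analysis.ODE

/-! ## Cor. 6.11 as a predicate, bootstrap times, the conclusion of Prop. 6.12 -/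

/-- **The exit trichotomy of Cor. 6.11 at time `T`**: (6.101) backwards flow of energy
`Ẽ₋₁(T) = K⁻¹⁰ (1+ε₀)^{1/5}`, or (6.102) forwards flow `|d₁(T)| = ½ K⁻¹⁰`, or (6.103) running out the
clock `T = 100`. [cite: Tao2016AveragedNS, §6.5 Cor. 6.11 (6.101)–(6.103)] -/
def ExitTrichotomy (ε₀ K : ℝ) (Xr : Fin 4 → ℤ → ℝ → ℝ) (Er : ℤ → ℝ → ℝ) (T : ℝ) : Prop :=
  Er (-1) T = (K ^ 10)⁻¹ * (1 + ε₀) ^ ((1 : ℝ) / 5) ∨ |Xr 3 1 T| = 1 / 2 * (K ^ 10)⁻¹ ∨ T = 100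

/-- **A bootstrap time**: a time `0 < T ≤ 100` up to which (6.92)–(6.95) (`GoodAt`) hold and at which
the exit trichotomy of Cor. 6.11 holds — the three properties of the maximal time `T₁` of §6.5
that Props. 6.12–6.17 use. [cite: Tao2016AveragedNS, §6.5 (6.92)–(6.95), Cor. 6.11] -/
structure IsBootstrapTime (ε₀ K : ℝ) (Xr : Fin 4 → ℤ → ℝ → ℝ) (Er : ℤ → ℝ → ℝ) (T : ℝ) :
    Prop where
  /-- `0 < T₁` -/
  pos : 0 < T
  /-- `T₁ ≤ 100` -/
  le_hundred : T ≤ 100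
  /-- (6.92)–(6.95) on `[0, T₁]` -/
  good : ∀ t ∈ Icc 0 T, GoodAt ε₀ K Xr Er t
  /-- Cor. 6.11 at `T₁` -/
  exit : ExitTrichotomy ε₀ K Xr Er T

/-- **The conclusion (6.104)–(6.114) of Prop. 6.12 (reduced induction claim)**, `X₃`-coefficient
`γ`, relative to the bootstrap time `T₁`: (6.104) `1/100 ≤ τ₁ ≤ T₁`;
(6.105) `(1+ε₀)^{-1/100} ≤ μ₁ ≤ (1+ε₀)^{1/100}`; (6.106) `a₁(τ₁) = μ₁`; (6.107) `|b₁(τ₁)| ≤ 10⁻⁵ ε μ₁`;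
(6.108)_γ `|c₁(τ₁)| ≤ γ ε² μ₁` (printed `γ = 10⁻⁵e^{-K¹⁰}`, corrected `10⁻⁵e^{-K¹⁰/2}`);
(6.109) `c₁(τ₁) ≥ -(1+ε₀)^{-n₀/4} μ₁`; (6.110) `Ẽ₀(τ₁) ≤ K⁻²⁰ μ₁²`; (6.111)–(6.112)
`10⁻⁵ ε μ₁ ≤ b₀(τ₁) ≤ 10⁵ ε μ₁`; (6.113)–(6.114) `e^{K⁹} ε² μ₁ ≤ c₀(τ₁) ≤ e^{K¹⁰} ε² μ₁`.
[cite: Tao2016AveragedNS, §6.5 Prop. 6.12 (6.104)–(6.114)] -/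
structure ReducedConclusion (γ ε₀ K ε : ℝ) (n₀ : ℤ) (Xr : Fin 4 → ℤ → ℝ → ℝ) (Er : ℤ → ℝ → ℝ)
    (T₁ τ₁ μ₁ : ℝ) : Prop where
  /-- (6.104), lower -/
  tau_ge : 1 / 100 ≤ τ₁
  /-- (6.104), upper -/
  tau_le : τ₁ ≤ T₁
  /-- (6.105), lower -/
  mu_ge : (1 + ε₀) ^ (-(1 : ℝ) / 100) ≤ μ₁
  /-- (6.105), upper -/
  mu_le : μ₁ ≤ (1 + ε₀) ^ ((1 : ℝ) / 100)
  /-- (6.106) -/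
  a_eq : Xr 0 1 τ₁ = μ₁
  /-- (6.107) -/
  b_abs_le : |Xr 1 1 τ₁| ≤ 1 / 10 ^ 5 * ε * μ₁
  /-- (6.108)_γ -/
  c_abs_le : |Xr 2 1 τ₁| ≤ γ * ε ^ 2 * μ₁
  /-- (6.109) -/
  c_ge : -((1 + ε₀) ^ (-(n₀ : ℝ) / 4) * μ₁) ≤ Xr 2 1 τ₁
  /-- (6.110) -/
  energy_le : Er 0 τ₁ ≤ (K ^ 20)⁻¹ * μ₁ ^ 2
  /-- (6.111) -/
  b_prev_ge : 1 / 10 ^ 5 * ε * μ₁ ≤ Xr 1 0 τ₁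
  /-- (6.112) -/
  b_prev_le : Xr 1 0 τ₁ ≤ 10 ^ 5 * ε * μ₁
  /-- (6.113) -/
  c_prev_ge : Real.exp (K ^ 9) * ε ^ 2 * μ₁ ≤ Xr 2 0 τ₁
  /-- (6.114) -/
  c_prev_le : Xr 2 0 τ₁ ≤ Real.exp (K ^ 10) * ε ^ 2 * μ₁

/-! ## Prop. 6.12 as a named fact -/

/-- **Tao's Prop. 6.12 (reduced induction claim), `X₃`-coefficient `γ`**, stated for an arbitrary
bootstrap time `T₁` (`IsBootstrapTime`: `0 < T₁ ≤ 100`, (6.92)–(6.95) on `[0, T₁]`, Cor. 6.11 at `T₁` —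
all that §6.6–6.7 use about `T₁`): in the regime of Prop. 6.5, every datum obeying (i)–(ix) and every
such `T₁` admit `τ₁ ∈ [1/100, T₁]`, `μ₁` obeying (6.104)–(6.114). Proved in the source from
Props. 6.13 and 6.15 (§6.6–6.7). A named fact (schema in `γ`; the printed proof establishes
`γ K = 10⁻⁵ exp(-K¹⁰/2)`, `reducedClaimCorrected`). [cite: Tao2016AveragedNS, §6.5 Prop. 6.12] -/
def reducedClaimWith (γ : ℝ → ℝ) : Prop :=
  InRegime γ fun D => ∀ T₁ : ℝ, IsBootstrapTime D.ε₀ D.K D.Y D.F T₁ →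
    ∃ τ₁ μ₁ : ℝ, ReducedConclusion (γ D.K) D.ε₀ D.K D.ε D.n₀ D.Y D.F T₁ τ₁ μ₁

/-- **Prop. 6.12 with the corrected coefficient `10⁻⁵ exp(-K¹⁰/2)`** (the erratum recorded in
`TaoCascadeBlowupDynamicsWith.lean`). A named fact.
[cite: Tao2016AveragedNS, §6.5 Prop. 6.12; §6.6 Prop. 6.13 (6.117)] -/
def reducedClaimCorrected : Prop :=
  reducedClaimWith fun K => 1 / 10 ^ 5 * Real.exp (-K ^ 10 / 2)

/-! ## Prop. 6.5 from Prop. 6.12 at a bootstrap time (pointwise) -/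

section Pointwise

variable {γ ε₀ K ε C₁ C₂ C₃ : ℝ} {n₀ N : ℤ} {τ : ℤ → ℝ} {Xr : Fin 4 → ℤ → ℝ → ℝ} {Er : ℤ → ℝ → ℝ}

/-- **The conclusion (6.67)–(6.81) of Prop. 6.5 from that of Prop. 6.12** at a bootstrap time:
(6.79)–(6.81) are (6.92)–(6.94) on `[0, τ₁] ⊆ [0, T₁]`, and (6.73) is (6.95) at `τ₁` together with
`μ₁ ≥ (1+ε₀)^{-1/100} ≥ ½`. [cite: Tao2016AveragedNS, §6.5, paragraph after Prop. 6.12] -/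
theorem RescaledConclusion.of_reduced {T₁ τ₁ μ₁ : ℝ} (hε₀ : 0 < ε₀) (hε₀1 : ε₀ < 1) (hK : 0 < K)
    (hT : IsBootstrapTime ε₀ K Xr Er T₁) (hr : ReducedConclusion γ ε₀ K ε n₀ Xr Er T₁ τ₁ μ₁) :
    RescaledConclusion γ ε₀ K ε n₀ Xr Er τ₁ μ₁ := by
  have hτ₁ : τ₁ ∈ Icc 0 T₁ := ⟨by linarith [hr.tau_ge], hr.tau_le⟩
  have hB : ∀ t ∈ Icc 0 τ₁, GoodAt ε₀ K Xr Er t := fun t ht =>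
    hT.good t ⟨ht.1, ht.2.trans hr.tau_le⟩
  -- `μ₁ ≥ (1+ε₀)^{-1/100} ≥ (1+ε₀)^{-1} ≥ 1/2`
  have hμ : 1 / 2 ≤ μ₁ := by
    have h1 : (1 : ℝ) ≤ 1 + ε₀ := by linarith
    have h2 : (1 + ε₀) ^ (-(1 : ℝ)) ≤ (1 + ε₀) ^ (-(1 : ℝ) / 100) :=
      Real.rpow_le_rpow_of_exponent_le h1 (by norm_num)
    have h3 : (1 + ε₀) ^ (-(1 : ℝ)) = (1 + ε₀)⁻¹ := Real.rpow_neg_one _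
    have h4 : (1 / 2 : ℝ) ≤ (1 + ε₀)⁻¹ := by
      rw [le_inv_comm₀ (by norm_num) (by linarith)]; norm_num; linarith
    linarith [hr.mu_ge]
  refine ⟨hr.tau_ge, hr.tau_le.trans hT.le_hundred, hr.mu_ge, hr.mu_le, hr.a_eq, hr.b_abs_le,
    hr.c_abs_le, hr.c_ge, ?_, hr.energy_le, hr.b_prev_ge, hr.b_prev_le, hr.c_prev_ge, hr.c_prev_le,
    fun m hm t ht => (hB t ht).before m hm, fun t ht => (hB t ht).during,
    fun m hm t ht => (hB t ht).after m hm⟩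
  -- (6.73)
  have hd := (hB τ₁ ⟨hτ₁.1, le_rfl⟩).d_le
  have hK10 : 0 ≤ (K ^ 10)⁻¹ := by positivity
  calc |Xr 3 1 τ₁| ≤ 1 / 2 * (K ^ 10)⁻¹ := hd
    _ = (K ^ 10)⁻¹ * (1 / 2) := by ring
    _ ≤ (K ^ 10)⁻¹ * μ₁ := mul_le_mul_of_nonneg_left hμ hK10

/-- **`T₁` is a bootstrap time as soon as Cor. 6.11 holds at `T₁`** (with `GoodAt` at `0`, `K ≥ 2`):
`GoodAt` holds on `[0, T₁]`, `T₁ ≤ 100`, and `T₁ > 0` because at `t = 0` the exits (6.101), (6.102)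
are excluded by the strict initial bounds of Lemma 6.8 (`Ẽ₋₁(0) ≤ (1+ε₀)^{-2/25} K⁻¹⁰ (1+ε₀)^{1/5}`,
`|d₁(0)| ≤ √2 K⁻¹⁵ < ½ K⁻¹⁰`) ("from Lemma 6.8 we see that `T₁ ≠ 0`, thus `0 < T₁ ≤ 100`").
[cite: Tao2016AveragedNS, §6.5, paragraph before Lemma 6.10] -/
theorem RescaledHypotheses.isBootstrapTime_T1
    (h : RescaledHypotheses γ ε₀ K ε C₁ C₂ C₃ n₀ N τ Xr Er) (hε₀ : 0 < ε₀) (hK : 2 ≤ K)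
    (hN : n₀ ≤ N) (h0 : GoodAt ε₀ K Xr Er 0)
    (hexit : ExitTrichotomy ε₀ K Xr Er (T1 ε₀ K Xr Er)) :
    IsBootstrapTime ε₀ K Xr Er (T1 ε₀ K Xr Er) := by
  have hq0 : (0 : ℝ) < 1 + ε₀ := by linarith
  have hq1 : (1 : ℝ) < 1 + ε₀ := by linarith
  have hK0 : 0 < K := by linarith
  have hK1 : 1 ≤ K := by linarith
  have hmem := T1_mem h0
  refine ⟨?_, hmem.2, fun t ht => h.goodAt_of_mem_T1 hN h0 ht, hexit⟩
  rcases eq_or_lt_of_le hmem.1 with h0T | h0T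
  · exfalso
    rcases hexit with h1 | h2 | h3
    · -- `Ẽ₋₁(0) < K⁻¹⁰ (1+ε₀)^{1/5}`
      rw [← h0T] at h1
      have hb := h.energy_zero_before hε₀ hK1 hN 2 le_rfl
      have hi : (1 : ℤ) - ((2 : ℕ) : ℤ) = -1 := by norm_num
      have hc : (((2 : ℕ) : ℝ)) / 10 = (1 : ℝ) / 5 := by norm_num
      rw [hi, hc, h1] at hb
      have hlt : (1 + ε₀) ^ (-(2 : ℝ) / 25) < 1 :=
        Real.rpow_lt_one_of_one_lt_of_neg hq1 (by norm_num)
      have hp : 0 < (K ^ 10)⁻¹ * (1 + ε₀) ^ ((1 : ℝ) / 5) := by positivity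
      nlinarith
    · -- `|d₁(0)| ≤ √2 K⁻¹⁵ < ½ K⁻¹⁰`
      rw [← h0T] at h2
      have hd := h.abs_d_one_zero_le hε₀ hK0 hN
      rw [h2] at hd
      have hK5pos : 0 < K ^ 5 := by positivity
      have hK10 : 0 < (K ^ 10)⁻¹ := by positivity
      have : 1 / 2 * (K ^ 10)⁻¹ ≤ Real.sqrt 2 * (K ^ 5)⁻¹ * (K ^ 10)⁻¹ := by
        calc 1 / 2 * (K ^ 10)⁻¹ ≤ Real.sqrt 2 * (K ^ 15)⁻¹ := hd
          _ = Real.sqrt 2 * (K ^ 5)⁻¹ * (K ^ 10)⁻¹ := by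
              rw [show K ^ 15 = K ^ 5 * K ^ 10 by ring, mul_inv, mul_assoc]
      have h' : 1 / 2 ≤ Real.sqrt 2 * (K ^ 5)⁻¹ := le_of_mul_le_mul_right this hK10
      rw [← div_eq_mul_inv, le_div_iff₀ hK5pos] at h'
      have hs : Real.sqrt 2 < 3 / 2 := (Real.sqrt_lt' (by norm_num)).2 (by norm_num)
      have hK5 : (32 : ℝ) ≤ K ^ 5 := by
        calc (32 : ℝ) = 2 ^ 5 := by norm_num
          _ ≤ K ^ 5 := pow_le_pow_left₀ (by norm_num) hK 5
      nlinarith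
    · norm_num [← h0T] at h3
  · exact h0T

end Pointwise

/-! ## Assembly in the regime -/

/-- **`GoodAt` at `t = 0` in the regime** (Lemma 6.8, from `goodAt_zero`), for every
`X₃`-coefficient `γ(K) ≤ 10⁻⁵`. [cite: Tao2016AveragedNS, §6.5 Lemma 6.8] -/
theorem goodAt_zero_inRegime {γ : ℝ → ℝ} (hγ : ∀ K, 0 < K → γ K ≤ 1 / 10 ^ 5) :
    InRegime γ fun D => GoodAt D.ε₀ D.K D.Y D.F 0 := by
  have hK : InRegime γ fun D => 2 ≤ D.K :=
    InRegime.of_K (p := fun _ _ K => 2 ≤ K) fun _ _ _ _ _ => eventually_ge_atTop 2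
  have hε : InRegime γ fun D => D.ε ≤ 1 := by
    refine InRegime.of_eps (p := fun _ _ _ ε => ε ≤ 1) fun _ _ _ _ _ _ _ => ?_
    have : Iio (1 : ℝ) ∈ 𝓝[>] (0 : ℝ) := mem_nhdsWithin_of_mem_nhds (Iio_mem_nhds (by norm_num))
    exact Filter.mem_of_superset this fun ε (hε : ε < 1) => (le_of_lt hε : ε ≤ 1)
  have hn : InRegime γ fun D =>
      D.C₂ * cumEnergyConst D.ε₀ D.C₃ * (1 + D.ε₀) ^ (-(D.n₀ : ℝ) / 2) ≤ 1 / 100 := by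
    refine InRegime.of_n0
      (p := fun ε₀ _ _ _ C₂ C₃ n₀ => C₂ * cumEnergyConst ε₀ C₃ * (1 + ε₀) ^ (-(n₀ : ℝ) / 2) ≤ 1 / 100)
      fun ε₀ K ε C₁ C₂ C₃ hε₀ _ _ _ _ _ _ => ?_
    exact eventually_mul_rpow_neg_half_le hε₀ _ (by norm_num)
  refine ((hK.and hε).and hn).mono ?_
  rintro D hD ⟨⟨hKD, hεD⟩, hnD⟩
  refine hD.hyp.goodAt_zero hD.ε₀_pos hD.ε₀_lt_one (hγ D.K hD.K_pos) hKD hD.ε_pos hεD hD.C₂_nonneg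
    hD.C₃_nonneg hD.n₀_le_N ?_
  calc D.C₂ * (1 + D.ε₀) ^ (-(D.n₀ : ℝ) / 2) * cumEnergyConst D.ε₀ D.C₃
      = D.C₂ * cumEnergyConst D.ε₀ D.C₃ * (1 + D.ε₀) ^ (-(D.n₀ : ℝ) / 2) := by ring
    _ ≤ 1 / 100 := hnD

/-- **Prop. 6.5 (`C₃` before `K₀`, coefficient `γ ≤ 10⁻⁵`) from a bootstrap time and Prop. 6.12**:
if in the regime every datum admits a bootstrap time, and Prop. 6.12 holds, then
`rescaledStepWith' γ`. [cite: Tao2016AveragedNS, §6.5, paragraph after Prop. 6.12] -/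
theorem rescaledStepWith'_of_isBootstrapTime {γ : ℝ → ℝ}
    (hT : InRegime γ fun D => ∃ T₁ : ℝ, IsBootstrapTime D.ε₀ D.K D.Y D.F T₁)
    (h12 : reducedClaimWith γ) : rescaledStepWith' γ := by
  rw [rescaledStepWith'_iff_inRegime]
  refine (hT.and h12).mono ?_
  rintro D hD ⟨⟨T₁, hT₁⟩, h12D⟩
  obtain ⟨τ₁, μ₁, hr⟩ := h12D T₁ hT₁
  exact ⟨τ₁, μ₁, RescaledConclusion.of_reduced hD.ε₀_pos hD.ε₀_lt_one hD.K_pos hT₁ hr⟩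

/-- **Prop. 6.5 (`C₃` before `K₀`) from Cor. 6.11 at `T₁` and Prop. 6.12**, for every coefficient
`γ(K) ≤ 10⁻⁵` (Lemma 6.8 enters through `goodAt_zero`): the deduction "the task of proving
Proposition 6.5 has now reduced to [Prop. 6.12]" of §6.5, with Cor. 6.11 at the maximal time `T1` as
the remaining input. [cite: Tao2016AveragedNS, §6.5 Cor. 6.11, Prop. 6.12] -/
theorem rescaledStepWith'_of_reducedClaim {γ : ℝ → ℝ} (hγ : ∀ K, 0 < K → γ K ≤ 1 / 10 ^ 5)
    (h11 : InRegime γ fun D => ExitTrichotomy D.ε₀ D.K D.Y D.F (T1 D.ε₀ D.K D.Y D.F))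
    (h12 : reducedClaimWith γ) : rescaledStepWith' γ := by
  have hK : InRegime γ fun D => 2 ≤ D.K :=
    InRegime.of_K (p := fun _ _ K => 2 ≤ K) fun _ _ _ _ _ => eventually_ge_atTop 2
  refine rescaledStepWith'_of_isBootstrapTime ?_ h12
  refine (((goodAt_zero_inRegime hγ).and h11).and hK).mono ?_
  rintro D hD ⟨⟨h0, h11D⟩, hKD⟩
  exact ⟨_, hD.hyp.isBootstrapTime_T1 hD.ε₀_pos hKD hD.n₀_le_N h0 h11D⟩

/-- **The corrected Prop. 6.5 (`rescaledStepCorrected'`) from Cor. 6.11 at `T₁` and the corrected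
Prop. 6.12.** [cite: Tao2016AveragedNS, §6.5 Cor. 6.11, Prop. 6.12] -/
theorem rescaledStepCorrected'_of_reducedClaim
    (h11 : InRegime (fun K => 1 / 10 ^ 5 * Real.exp (-K ^ 10 / 2)) fun D =>
      ExitTrichotomy D.ε₀ D.K D.Y D.F (T1 D.ε₀ D.K D.Y D.F))
    (h12 : reducedClaimCorrected) : rescaledStepCorrected' := by
  refine rescaledStepWith'_of_reducedClaim (fun K _ => ?_) h11 h12
  have h1 : Real.exp (-K ^ 10 / 2) ≤ 1 := Real.exp_le_one_iff.2 (by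
    have : 0 ≤ K ^ 10 := by positivity
    linarith)
  have h2 : 0 ≤ Real.exp (-K ^ 10 / 2) := (Real.exp_pos _).le
  nlinarith

end TaoCascade

end Literature.Analysis.FluidPDE
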